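import Literature.NumberTheory.EllipticCurves.Sprung2012.SharpFlatSelmer
import Literature.NumberTheory.EllipticCurves.IwasawaSelmerDualProofs
import Literature.NumberTheory.EllipticCurves.IwasawaAlgebraSpecializationTorsionBoundFamilyProofs
import Literature.NumberTheory.EllipticCurves.IwasawaAlgebraCharIdealProofs
import Literature.GroupTheory.FiniteAbelian.CharacterModuleUnitAddCircle
import Summits.BirchSwinnertonDyer.BirchSwinnertonDyer.Theorems.ByReductionTypeAtTwoSupersingularOrderTwoNakayama
import Summits.BirchSwinnertonDyer.BirchSwinnertonDyer.Theorems.ErratumRoadFiveCharIdealTransferTorsion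
import Mathlib.Algebra.Module.CharacterModule
import Mathlib.GroupTheory.FiniteAbelian.Basic
import HarnessLib

/-!
# Route `ByReductionTypeAtTwo` (rung K4), crux `SupersingularRankZeroAtTwo` (item stmt-BirchSwinnertonDyer-19097), hand hK87-C
# (-imc's K87-C `BlindZeroOfTwistSelmerCorankAtTwo`), steps (S4)–(S5): **if `(T+2) ∤ char X•` then the
# `conj_γ`-ANTI-INVARIANTS of `Sel•(E/ℚ_∞)` form a FINITE group** (cell `bsd-2adic`, seat `bsd-2adic-t42` GEN 46;
# `--supports 19097`, helper)

HONEST FRAMING (D-0036/D-0054): THEOREMS ONLY (no definition, no named fact, no `sorry`, no instance). Nothing about any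
curve is asserted; 19097 OPEN; BSD proved for no curve. This file is the Pontryagin/`Λ`-algebra end of -imc's mechanism
(D87 `Cruxes/SupersingularRankZeroAtTwo/D87TwistPointPinchAtTwo.lean` §1, steps (S4)(S5)), in CONTRAPOSITIVE form:

* §1 (`Λ = ℤ₂⟦T⟧`, any f.g. torsion `X` with `char X = (ξ)`): **`(T+2) ∤ ξ ⟹ X/(T+2)X` is finite**
  (`finite_quotient_X_add_C_two_of_not_dvd`): `ℓ_{(T+2)}(X) = 0` (else `char X ⊆ (T+2)`, tree
  `X11b.CongruenceLimit.charIdeal_le_pow_lengthAt`), so some annihilator `s` of `X` lies outside the prime `(T+2)`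
  (`prime_X_add_C_two`), and `X/(T+2)X` is a module over the finite ring `Λ/(s, T+2)` (tree
  `IwasawaAlgebra.finite_of_smul_eq_zero_of_prime_not_dvd`).
* §2 (generic groups): a torsion abelian group with finite character group `Hom(A, ℚ/ℤ)` is finite
  (`finite_of_isTorsion_of_finite_characterModule`: finite subgroups `B ≤ A` have `#B = #Hom(B, ℚ/ℤ) ≤ #Hom(A, ℚ/ℤ)`
  by `CharacterModule.dual_surjective_of_injective` and `CharacterModuleUnitAddCircle.nonempty_characterModule_addEquiv`;
  a torsion group with bounded finite subgroups is finite, `AddCommGroup.finite_of_fg_torsion`).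
* §3 (any `K`, `p`, Sprung datum `D : SharpFlatSelmerDualData W κ γ ι ap g c col`): the restriction of `D.toDual` to the
  anti-invariants `A = {s ∈ Sel• : conj_γ s = −s}` is ONTO `Hom(A, ℚ/ℤ)` and kills `(T+2)·X•` — because
  `((T+2)x)(s) = x(conj_γ s) − x(s) + 2x(s) = x(conj_γ s + s) = 0` (`toDual_T_smul`) — so
  **`X•/(T+2)X• finite ⟹ A finite`** (`finite_antiInvariants_of_finite_quotient`; `A` is `p`-primary torsion as a subgroup
  of `H¹(K_∞, E[p^∞])`, tree `exists_pow_smul_subgroupH1_ker_eq_zero`). The anti-invariants are written as the subgroup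
  `sharpFlatSelmerInfty ⊓ ker(conj_γ + 1)` of `H¹(K_∞, E[p^∞])` (no new definition).

References: [Sprung2012] Def. 7.9/7.11, Thm. 7.14; [GreenbergLNM1716] §1 pp. 60, 65 (`X/(γ − χ(γ))X` and the
`χ`-part of the Selmer group); [Washington1997] §13.2; [SerreLocalFields1979] VII §5.
-/

set_option autoImplicit false
-- the Theorems namespace of this sub repeats the summit name by design (D-0017 nested layout)
set_option linter.dupNamespace false

noncomputable section

open scoped Classical

universe u

namespace Summit.BirchSwinnertonDyer.BirchSwinnertonDyer.Theorems

namespace BlindPinch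

open WeierstrassCurve Literature.NumberTheory.EllipticCurves Literature.NumberTheory.EllipticCurves.Sprung2012
  Literature.NumberTheory.EllipticCurves.Sprung2017 Literature.NumberTheory.GaloisRepresentations ZpExtension

/-! ## §1 `(T+2) ∤ ξ ⟹ X/(T+2)X` finite -/

section Algebra

variable {M : Type u} [AddCommGroup M] [Module (IwasawaAlgebra 2) M]

/-- **`(T+2) ∤ char X ⟹ X/(T+2)X` is FINITE** for a finitely generated torsion `Λ = ℤ₂⟦T⟧`-module `X` with
`char X = (ξ)`: the local length of `X` at the height-one prime `(T+2)` vanishes (otherwise `char X ⊆ (T+2)`), so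
the annihilator of `X` is not contained in `(T+2)`, and `X/(T+2)X` is killed by `(T+2)` and by an annihilator
`s ∉ (T+2)`, hence is a module over the finite ring `Λ/(s, T+2)`. [cite: Washington1997, §13.2]
[cite: GreenbergLNM1716, §1 p. 65] -/
theorem finite_quotient_X_add_C_two_of_not_dvd [Module.Finite (IwasawaAlgebra 2) M]
    (hM : Module.IsTorsion (IwasawaAlgebra 2) M) {ξ : IwasawaAlgebra 2}
    (hchar : Module.charIdeal (IwasawaAlgebra 2) M = Ideal.span {ξ})
    (hndvd : ¬ (PowerSeries.X + PowerSeries.C (2 : ℤ_[2]) : IwasawaAlgebra 2) ∣ ξ) :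
    Finite (M ⧸ (Ideal.span {(PowerSeries.X + PowerSeries.C (2 : ℤ_[2]) : IwasawaAlgebra 2)} •
      (⊤ : Submodule (IwasawaAlgebra 2) M))) := by
  classical
  set π : IwasawaAlgebra 2 := PowerSeries.X + PowerSeries.C (2 : ℤ_[2]) with hπ
  have hprime : Prime π := prime_X_add_C_two
  obtain ⟨𝔭, h𝔭⟩ : ∃ 𝔭 : PrimeSpectrum (IwasawaAlgebra 2), 𝔭.asIdeal = Ideal.span {π} :=
    ⟨⟨Ideal.span {π}, (Ideal.span_singleton_prime hprime.ne_zero).mpr hprime⟩, rfl⟩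
  have h𝔭1 : 𝔭.asIdeal.height = 1 := by
    rw [h𝔭]; exact Module.height_span_singleton_eq_one_of_prime hprime
  -- `ℓ_𝔭(M) = 0`, otherwise `char M ⊆ 𝔭`, i.e. `π ∣ ξ`
  have hlen : Module.lengthAt (IwasawaAlgebra 2) M 𝔭 = 0 := by
    by_contra hne
    apply hndvd
    obtain ⟨s, hs, hs0⟩ := Submodule.annihilator_top_inter_nonZeroDivisors hM
    have hsM : Module.IsTorsionBy (IwasawaAlgebra 2) M s := fun x ↦
      Submodule.mem_annihilator.mp hs x Submodule.mem_top
    have htop := Module.lengthAt_ne_top_of_isTorsionBy (nonZeroDivisors.ne_zero hs0) hsM 𝔭 h𝔭1.le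
    have hn : (Module.lengthAt (IwasawaAlgebra 2) M 𝔭).toNat ≠ 0 := by
      rw [Ne, ENat.toNat_eq_zero, not_or]; exact ⟨hne, htop⟩
    have hle : Module.charIdeal (IwasawaAlgebra 2) M ≤ 𝔭.asIdeal :=
      (Summit.BirchSwinnertonDyer.Rank1Residual.X11b.CongruenceLimit.charIdeal_le_pow_lengthAt hM 𝔭 h𝔭1).trans
        (Ideal.pow_le_self hn)
    rw [hchar, h𝔭, Ideal.span_singleton_le_iff_mem] at hle
    exact Ideal.mem_span_singleton.mp hle
  -- hence an annihilator outside `𝔭`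
  have hsub : Subsingleton (LocalizedModule 𝔭.asIdeal.primeCompl M) := by
    have h := hlen
    rw [Module.lengthAt] at h
    exact Module.length_eq_zero_iff.mp h
  have hsupp : 𝔭 ∉ Module.support (IwasawaAlgebra 2) M := Module.notMem_support_iff.mpr hsub
  have hann : ¬ Module.annihilator (IwasawaAlgebra 2) M ≤ 𝔭.asIdeal :=
    fun h ↦ hsupp (Module.mem_support_iff_of_finite.mpr h)
  obtain ⟨s, hs, hs𝔭⟩ := SetLike.not_le_iff_exists.mp hann
  have hsdvd : ¬ π ∣ s := fun h ↦ hs𝔭 (h𝔭 ▸ Ideal.mem_span_singleton.mpr h)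
  -- `M/πM` is killed by `s` and by `π`
  refine IwasawaAlgebra.finite_of_smul_eq_zero_of_prime_not_dvd 2 hprime hsdvd (fun x ↦ ?_) (fun x ↦ ?_)
  · induction x using Submodule.Quotient.induction_on with
    | H m =>
      rw [← Submodule.Quotient.mk_smul, Module.mem_annihilator.mp hs m, Submodule.Quotient.mk_zero]
  · induction x using Submodule.Quotient.induction_on with
    | H m =>
      rw [← Submodule.Quotient.mk_smul, Submodule.Quotient.mk_eq_zero]
      exact Submodule.smul_mem_smul (Ideal.mem_span_singleton_self π) Submodule.mem_top

end Algebra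

/-! ## §2 A torsion group with finite character group is finite -/

section Character

variable {A : Type u} [AddCommGroup A]

/-- **A torsion abelian group whose character group `Hom(A, ℚ/ℤ)` is finite is finite.** Every finite subgroup
`B ≤ A` satisfies `#B = #Hom(B, ℚ/ℤ) ≤ #Hom(A, ℚ/ℤ)` (restriction of characters is onto, `ℚ/ℤ` being divisible), and a
torsion abelian group all of whose finitely generated (= finite) subgroups are bounded is finite.
[cite: SerreLocalFields1979, VII §5 (duality for finite groups)] -/
theorem finite_of_isTorsion_of_finite_characterModule (hA : AddMonoid.IsTorsion A)
    [hfin : Finite (CharacterModule A)] : Finite A := by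
  by_contra hinf
  rw [not_finite_iff_infinite] at hinf
  -- a finite subset with more elements than there are characters
  obtain ⟨s, hs⟩ := Infinite.exists_subset_card_eq A (Nat.card (CharacterModule A) + 1)
  let B : AddSubgroup A := AddSubgroup.closure (s : Set A)
  have hBtors : AddMonoid.IsTorsion B := fun b ↦
    ((AddSubgroup.subtype_injective B).isOfFinAddOrder_iff (f := B.subtype)).mp (hA (b : A))
  haveI : Finite B := AddCommGroup.finite_of_fg_torsion B hBtors
  -- `#B = #Hom(B, ℚ/ℤ) ≤ #Hom(A, ℚ/ℤ)`
  obtain ⟨eB⟩ := Literature.GroupTheory.FiniteAbelian.nonempty_characterModule_addEquiv B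
  have hsurj : Function.Surjective (CharacterModule.dual (B.subtype.toIntLinearMap)) :=
    CharacterModule.dual_surjective_of_injective _ (AddSubgroup.subtype_injective B)
  have hcard : Nat.card B ≤ Nat.card (CharacterModule A) := by
    rw [← Nat.card_congr eB.toEquiv]
    exact Nat.card_le_card_of_surjective _ hsurj
  -- but `s ⊆ B` has `#Hom(A, ℚ/ℤ) + 1` elements
  have hsB : (s : Set A) ⊆ B := AddSubgroup.subset_closure
  have hle : s.card ≤ Nat.card B := by
    rw [← Nat.card_eq_finsetCard s]
    exact Nat.card_le_card_of_injective (fun x : (s : Set A) ↦ (⟨(x : A), hsB x.2⟩ : B))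
      (fun x y h ↦ Subtype.ext (congrArg (fun b : B ↦ (b : A)) h))
  omega

end Character

/-! ## §3 The anti-invariants of `Sel•(E/K_∞)` are finite when `X•/(T+2)X•` is -/

section AntiInvariants

variable {K : Type u} [Field K] [NumberField K] {p : ℕ} [Fact p.Prime] {W : WeierstrassCurve K}
  {κ : ZpExtension K p} {γ : Field.absoluteGaloisGroup K} {E : Type u} [Field E] [Algebra K E]
  {ι : AlgebraicClosure K →ₐ[K] AlgebraicClosure E} {ap : ℤ} {g : Field.absoluteGaloisGroup E}
  {c : ℕ → localPoints W E} {col : Chroma}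

/-- `(T+2)·x` pairs to zero with every anti-invariant class: `((T+2)x)(s) = x(conj_γ s + s) = 0` when
`conj_γ s = −s` (`toDual_T_smul`; the constant `2 = C 2` acts as multiplication by `2`).
[cite: GreenbergLNM1716, §1 pp. 60, 65] [cite: Sprung2012, Def. 7.11 (the Λ-action)] -/
theorem toDual_X_add_C_two_smul_eq_zero (D : SharpFlatSelmerDualData W κ γ ι ap g c col) (x : D.X)
    (s : sharpFlatSelmerInfty W κ ι ap g c col)
    (hs : W.conjH1 p κ.kerSubgroup γ s = -(s : W.subgroupH1 p κ.kerSubgroup)) :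
    D.toDual ((PowerSeries.X + PowerSeries.C (2 : ℤ_[p]) : IwasawaAlgebra p) • x) s = 0 := by
  have h2 : (PowerSeries.C (2 : ℤ_[p]) : IwasawaAlgebra p) • x = 2 • x := by
    rw [map_ofNat, ← Nat.cast_ofNat, Nat.cast_smul_eq_nsmul]
  rw [add_smul, map_add, AddMonoidHom.add_apply, D.toDual_T_smul, h2, map_nsmul, AddMonoidHom.nsmul_apply]
  have hneg : (⟨W.conjH1 p κ.kerSubgroup γ s, D.conj_mem s s.2⟩ : sharpFlatSelmerInfty W κ ι ap g c col) = -s := by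
    apply Subtype.ext
    change W.conjH1 p κ.kerSubgroup γ s = ((-s : sharpFlatSelmerInfty W κ ι ap g c col) : W.subgroupH1 p κ.kerSubgroup)
    rw [AddSubgroup.coe_neg]
    exact hs
  rw [hneg, map_neg, two_nsmul]
  abel

/-- **`X•/(T+2)X•` finite ⟹ the `conj_γ`-anti-invariants of `Sel•(E/K_∞)` are finite** (any number field `K`,
prime `p`, `ℤ_p`-extension `κ`, `γ`, place datum `(ι, ap, g, c)`, chroma `col`, Sprung dual datum `D`): the
restriction `x ↦ x|_A` of `D.toDual` to `A = Sel• ∩ ker(conj_γ + 1)` is onto `Hom(A, ℚ/ℤ)` (`toDual` bijective,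
`ℚ/ℤ` injective) and kills `(T+2)·X•` (`toDual_X_add_C_two_smul_eq_zero`), so `Hom(A, ℚ/ℤ)` is a quotient of
`X•/(T+2)X•`; and `A` is `p`-primary. Dual form of «`X• ↠ ℤ₂` with `T ↦ −2`» in -imc's K87-C mechanism (S4).
[cite: GreenbergLNM1716, §1 pp. 60, 65] [cite: Sprung2012, Def. 7.11, Thm. 7.14] -/
theorem finite_antiInvariants_of_finite_quotient (D : SharpFlatSelmerDualData W κ γ ι ap g c col)
    [Finite (D.X ⧸ (Ideal.span {(PowerSeries.X + PowerSeries.C (2 : ℤ_[p]) : IwasawaAlgebra p)} •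
      (⊤ : Submodule (IwasawaAlgebra p) D.X)))] :
    Finite ↥(sharpFlatSelmerInfty W κ ι ap g c col ⊓
      (W.conjH1 p κ.kerSubgroup γ + AddMonoidHom.id (W.subgroupH1 p κ.kerSubgroup)).ker) := by
  set Sel := sharpFlatSelmerInfty W κ ι ap g c col with hSel
  set π : IwasawaAlgebra p := PowerSeries.X + PowerSeries.C (2 : ℤ_[p]) with hπ
  -- the anti-invariants as a subgroup `A'` of the subtype `Sel`
  let φ : Sel →+ W.subgroupH1 p κ.kerSubgroup :=
    (W.conjH1 p κ.kerSubgroup γ + AddMonoidHom.id (W.subgroupH1 p κ.kerSubgroup)).comp Sel.subtype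
  let A' : AddSubgroup Sel := φ.ker
  have hA' : ∀ s : Sel, s ∈ A' ↔ W.conjH1 p κ.kerSubgroup γ s = -(s : W.subgroupH1 p κ.kerSubgroup) := fun s ↦ by
    rw [AddMonoidHom.mem_ker]
    change W.conjH1 p κ.kerSubgroup γ s + (s : W.subgroupH1 p κ.kerSubgroup) = 0 ↔ _
    exact add_eq_zero_iff_eq_neg
  -- the restricted duality map `ρ : X → Hom(A', ℚ/ℤ)`, onto
  let ρ : D.X →+ CharacterModule A' :=
    (CharacterModule.dual (A'.subtype.toIntLinearMap)).toAddMonoidHom.comp D.toDual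
  have hρsurj : Function.Surjective ρ :=
    (CharacterModule.dual_surjective_of_injective _ (AddSubgroup.subtype_injective A')).comp D.bijective.2
  -- `ρ` kills `(T+2)·X`
  have hρπ : ∀ x : D.X, ρ (π • x) = 0 := fun x ↦ by
    ext a
    change D.toDual (π • x) (a : Sel) = 0
    exact toDual_X_add_C_two_smul_eq_zero D x a ((hA' a).mp a.2)
  let N : Submodule (IwasawaAlgebra p) D.X := Ideal.span {π} • ⊤
  have hN : N.toAddSubgroup ≤ ρ.ker := by
    intro x hx
    rw [AddMonoidHom.mem_ker]
    change x ∈ N at hx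
    refine Submodule.smul_induction_on hx (fun r hr n _ ↦ ?_) (fun x y hx hy ↦ by rw [map_add, hx, hy, add_zero])
    obtain ⟨b, rfl⟩ := Ideal.mem_span_singleton'.mp hr
    rw [mul_comm, mul_smul]
    exact hρπ (b • n)
  -- so `Hom(A', ℚ/ℤ)` is a quotient of the finite group `X/(T+2)X`
  let ρbar : D.X ⧸ N.toAddSubgroup →+ CharacterModule A' := QuotientAddGroup.lift N.toAddSubgroup ρ hN
  have hρbar : Function.Surjective ρbar := by
    intro χ
    obtain ⟨x, rfl⟩ := hρsurj χ
    exact ⟨QuotientAddGroup.mk x, rfl⟩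
  haveI : Finite (D.X ⧸ N.toAddSubgroup) := ‹Finite (D.X ⧸ N)›
  haveI : Finite (CharacterModule A') := Finite.of_surjective ρbar hρbar
  -- `A'` is torsion, hence finite
  have htors : AddMonoid.IsTorsion A' := fun a ↦ by
    obtain ⟨k, hk⟩ := W.exists_pow_smul_subgroupH1_ker_eq_zero κ
      (((a : Sel) : W.subgroupH1 p κ.kerSubgroup))
    refine isOfFinAddOrder_iff_nsmul_eq_zero.mpr ⟨p ^ k, pow_pos (Fact.out : p.Prime).pos k, ?_⟩
    apply Subtype.ext; apply Subtype.ext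
    simpa using hk
  haveI : Finite A' := finite_of_isTorsion_of_finite_characterModule htors
  -- `A' ≃ Sel ⊓ ker(conj_γ + 1)`
  refine Finite.of_injective (fun z : ↥(Sel ⊓ (W.conjH1 p κ.kerSubgroup γ + AddMonoidHom.id _).ker) ↦
    (⟨⟨(z : W.subgroupH1 p κ.kerSubgroup), (AddSubgroup.mem_inf.mp z.2).1⟩, ?_⟩ : A')) ?_
  · rw [AddMonoidHom.mem_ker]
    exact (AddMonoidHom.mem_ker).mp (AddSubgroup.mem_inf.mp z.2).2
  · intro z z' h
    exact Subtype.ext (congrArg (fun a : A' ↦ ((a : Sel) : W.subgroupH1 p κ.kerSubgroup)) h)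

end AntiInvariants

end BlindPinch

end Summit.BirchSwinnertonDyer.BirchSwinnertonDyer.Theorems

end
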